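import Summits.ResolutionOfSingularities.ResolutionOfSingularities.Theorems.EquisingularLiftEquisingularLiftNatNDInvInit
import Summits.ResolutionOfSingularities.ResolutionOfSingularities.Theorems.EquisingularLiftEquisingularLiftNatNDRoundModelSplit
import Summits.ResolutionOfSingularities.ResolutionOfSingularities.Theorems.EquisingularLiftEquisingularLiftNatNDChartPullback
import Summits.ResolutionOfSingularities.ResolutionOfSingularities.Theorems.FrobeniusLadderFInjectiveMacaulayficationSpreadSupportControl
import HarnessLib

/-!
# [OURS · L1 W4.5(b) · EL♮(3)] R33 (β) «ND-LEAVES» / K6 — brick `…NatNDLeafInit`: the LEAF-INIT SUPPLIER (stage-generic `ndInv_init`)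
# (desk DEAL «K6 PRE-WORK» 2026-08-28T16:01:38Z and RULING «R33 IN FORCE» 16:17:40Z: nose-w1 = (K6-L0) + (K6-L1) without adaptedness inputs)

Cell `res-hironaka`, crux EL♮(3) `EquisingularLiftNatThree` (stmt-ResolutionOfSingularities-20148), chain W4.5b.  res-L1-w45b-nose-w1 g0 (WIDTH seat,
(B4γ) owner — ✓ p645490 `ND.ndInv_init`).  OURS; NOT a statement of any manuscript; nothing of [Hironaka2017] is asserted; resolution of singularities in
positive characteristic is NOT proved here or by this; AI-written, weaker than expert review.  Def-free, `sorry`-free, standard axioms.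
`--kind proof --supports stmt-ResolutionOfSingularities-20148 --as helper`.  Word of record: `L/res-L1-w45b-nose-w1/K6-LEAF-INIT-v1.md` 3187576844c1c2ec.

WHAT THIS FILE IS.  The k-side round machinery of the ND rung (`ND.NDInvCLN`, port ✓ p643982; (B4α/β); `ndInvLN_round_of`) is stage-generic; only the
INITIAL brick (B4γ) `ND.ndInv_init` (p645490) is tied to `(ℙⁿ_k, 𝟙, range ι)`, and there in exactly two places: the chart presenting `𝒪_{ℙⁿ,x}` as
`k[t]_{𝔪_b}` and `isRegular_projectiveSpace`.  SPEC K6 v1 (`Cruxes/EquisingularLiftNatThree/NDLeavesRungK6.lean`, idea-1 g23) ends an A⁗-prefix at a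
LEAF stage `(F, ρ, T)` carrying `ND.NDInvCLN n k m F ρ T`.  This file is how a customer PRODUCES that datum at a leaf:

* §1 (K6-L0) `ndInvCLN_of_leafFrames` — THE SOCKET (packaging): `F` regular and locally Noetherian, `T` closed, a finite set `S` of closed points of the
  reduced closure `T̂` off which `T̂` is regular and on which it is not, and `ND.IsNDFrameAt` data at each point of `S` ⇒ `ND.NDInvCLN n k |S| F ρ T`.
* §2 `stalkIdeal_vanishingIdeal_eq_span_of_forall_isPrime` — the RADICAL COMPARISON, chart-free: if the primes of `𝒪_{F,x}` over `(𝓘_{T̂})_x` are exactly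
  those containing `h`, and `(h)` is radical, then `(𝓘_{T̂})_x = (h)` (`𝓘_{T̂}` is radical: reduced induced structure).
* §3 `exists_frame_of_leafChart` — THE FRAME at a point `x` of ANY locally Noetherian `F` presented by a LEAF CHART `χ : k[t] →+* 𝒪_{F,x}`
  (`IsLocalization.AtPrime` at `𝔪_b`, `χ ∘ C = ND.baseToStalk`) and an origin-fixing `θ`: ideal sheaves `W` with germs `w_j = χ((θ⁻¹ t_j)(t − b))`,
  `(w) = 𝔪_x`, `dim 𝒪_{F,x} = n`, `(θ (f(t + b)))(w) = χ f` (027 g20's `exists_frame`, p645036, with `ℙⁿ` replaced by `F`; the `W_j` from the tree's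
  `exists_idealSheafData_stalkIdeal_eq`, so `F` need not be integral).
* §4 (K6-L1) ★ `isNDFrameAt_of_leafChart` — THE SUPPLIER PROPER: leaf chart + a polynomial `f` cutting out `T̂` near `x` AT THE LEVEL OF POINTS
  (`∀ Q prime, (𝓘_{T̂})_x ≤ Q ↔ χ f ∈ Q`) + `LocalNDWon (θ (f(t + b)))` + `F` regular + `2 ≤ n` ⇒ `∃ W, ND.IsNDFrameAt n k ρ T W x`, and the IDEAL
  equality `(𝓘_{T̂})_x = (χ f)` (`stalkIdeal_eq_span_of_leafChart`): `χ f` is squarefree in the factorial `𝒪_{F,x}` by (γ5) `sq_dvd_false_of_localND`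
  (p644264) and the descent `squarefree_algebraMap_of_forall_not_sq_dvd` (p645490 §1), then §2.  `primes_iff_of_chart` turns the two chart clauses of
  `ND.exists_chartRingHom` (p643663) into the point-level hypothesis.
* §5 `isNDFrameAt_of_leafChart_prescribed` — the same with PRESCRIBED frame members (e.g. boundary members through `x` whose stalks are frame
  coordinates): the frame can be chosen to CONTAIN them (crit-2 S-C2-40a adaptedness, optional per R33-in-force; pure bookkeeping).

References (mathematics): H. Matsumura, *Commutative Ring Theory* (1986), §5 Example 5.1, Theorems 14.2–14.3, 20.3 [Matsumura1987]; R. Hartshorne,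
*Algebraic Geometry* (1977), II Example 3.2.6 [Hartshorne1977]; A. G. Kouchnirenko, Invent. Math. 32 (1976) 1–31 [Kouchnirenko1976].
-/

set_option linter.dupNamespace false

noncomputable section

open CategoryTheory AlgebraicGeometry TopologicalSpace IsLocalRing MvPolynomial
open AlgebraicGeometry.Scheme.IdealSheafData
open Literature.AlgebraicGeometry.Resolution
open Literature.AlgebraicGeometry.Motives

namespace Summit.ResolutionOfSingularities.ResolutionOfSingularities.Cruxes.EquisingularLiftNat.Sections.ND

open Summit.ResolutionOfSingularities.ResolutionOfSingularities.Cruxes.EquisingularLiftNat.Sections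
open Summit.ResolutionOfSingularities.ResolutionOfSingularities.Theorems.FInjectiveMacaulayfication.SpreadSupportControl

/-! ## §1 (K6-L0) The socket -/

section Socket

variable (n : ℕ) (k : Type) [Field k]

/-- **(K6-L0) `ndInvCLN_of_leafFrames` — THE SOCKET.**  At a k-side stage `(F, ρ, T)` with `F` regular and locally Noetherian and `T` closed: if `S` is
a finite set of CLOSED points of `F` on the reduced closure `T̂` of `T`, off which `T̂` is regular and on which it is not, and every `x ∈ S` carries local
ND frame data `ND.IsNDFrameAt n k ρ T W x`, then `ND.NDInvCLN n k |S| F ρ T` (port p643982). [OURS · K6 · packaging] -/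
theorem ndInvCLN_of_leafFrames (F : Scheme.{0}) (ρ : F ⟶ (projectiveSpace n k).left) (T : Set F)
    (hF : Scheme.IsRegular F) [IsLocallyNoetherian F] (hT : IsClosed T) (S : Finset F)
    (hS : ∀ z : ↥(vanishingIdeal (⟨closure T, isClosed_closure⟩ : Closeds F)).subscheme,
      IsRegularLocalRing ((vanishingIdeal (⟨closure T, isClosed_closure⟩ : Closeds F)).subscheme.presheaf.stalk z) ↔
        ((vanishingIdeal (⟨closure T, isClosed_closure⟩ : Closeds F)).subschemeι z : F) ∉ S)
    (hS' : ∀ x ∈ S, (∃ z : ↥(vanishingIdeal (⟨closure T, isClosed_closure⟩ : Closeds F)).subscheme,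
        ((vanishingIdeal (⟨closure T, isClosed_closure⟩ : Closeds F)).subschemeι z : F) = x) ∧ IsClosed ({x} : Set F) ∧
      ∃ W : Fin n → F.IdealSheafData, IsNDFrameAt n k ρ T W x) :
    NDInvCLN n k S.card F ρ T :=
  ⟨⟨⟨hF, S, rfl, hS, hS'⟩, hT⟩, inferInstance⟩

end Socket

/-! ## §2 The radical comparison (chart-free) -/

section Radical

variable {F : Scheme.{0}}

/-- The ideal sheaf of the reduced induced structure on a closed set is radical. [cite: Hartshorne1977, II Example 3.2.6] -/
theorem radical_vanishingIdeal (Z : Closeds F) : (vanishingIdeal Z).radical = vanishingIdeal Z := by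
  have hsupp : (vanishingIdeal Z).support = Z :=
    SetLike.coe_injective (AlgebraicGeometry.Scheme.IdealSheafData.coe_support_vanishingIdeal _)
  have h := vanishingIdeal_support (I := vanishingIdeal Z)
  rw [hsupp] at h
  exact h.symm

/-- The stalks of the ideal sheaf of a reduced induced structure are radical ideals. [cite: Hartshorne1977, II Example 3.2.6] -/
theorem isRadical_stalkIdeal_vanishingIdeal (Z : Closeds F) (x : F) : (stalkIdeal (vanishingIdeal Z) x).IsRadical :=
  Ideal.radical_eq_iff.mp (by rw [← stalkIdeal_radical, radical_vanishingIdeal])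

/-- **Radical comparison.**  If the prime ideals of `𝒪_{F,x}` over `(𝓘_Z)_x` (`𝓘_Z` the ideal sheaf of the reduced structure on the closed set `Z`)
are exactly the primes containing `h`, and `(h)` is a radical ideal, then `(𝓘_Z)_x = (h)`. [cite: Matsumura1987, §1 (radical = ⋂ primes)] -/
theorem stalkIdeal_vanishingIdeal_eq_span_of_forall_isPrime (Z : Closeds F) (x : F) (h : F.presheaf.stalk x)
    (hZ : ∀ Q : Ideal (F.presheaf.stalk x), Q.IsPrime → (stalkIdeal (vanishingIdeal Z) x ≤ Q ↔ h ∈ Q))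
    (hrad : (Ideal.span {h}).IsRadical) :
    stalkIdeal (vanishingIdeal Z) x = Ideal.span {h} := by
  rw [← (isRadical_stalkIdeal_vanishingIdeal Z x).radical, ← hrad.radical, Ideal.radical_eq_sInf, Ideal.radical_eq_sInf]
  congr 1
  ext Q
  constructor
  · rintro ⟨hle, hQ⟩
    exact ⟨(Ideal.span_singleton_le_iff_mem Q).mpr ((hZ Q hQ).mp hle), hQ⟩
  · rintro ⟨hle, hQ⟩
    exact ⟨(hZ Q hQ).mpr ((Ideal.span_singleton_le_iff_mem Q).mp hle), hQ⟩

/-- **From chart clauses to the point-level hypothesis.**  If a ring map `χ : R → 𝒪_{F,x}` presents the stalk of an ideal sheaf `I` as an extended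
ideal, `I_x = J·𝒪_{F,x}`, and for the primes `Q` of `𝒪_{F,x}` one has `J ≤ χ⁻¹Q ↔ f ∈ χ⁻¹Q` (the two clauses of `ND.exists_chartRingHom`, read at
the points of the chart specialising to `x`), then the primes over `I_x` are exactly those containing `χ f`. [folklore] -/
theorem primes_iff_of_chart {x : F} {R : Type*} [CommRing R] (χ : R →+* F.presheaf.stalk x) (I : F.IdealSheafData) (J : Ideal R)
    (hχI : stalkIdeal I x = J.map χ) (f : R)
    (hχT : ∀ Q : Ideal (F.presheaf.stalk x), Q.IsPrime → (J ≤ Q.comap χ ↔ f ∈ Q.comap χ)) :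
    ∀ Q : Ideal (F.presheaf.stalk x), Q.IsPrime → (stalkIdeal I x ≤ Q ↔ χ f ∈ Q) := by
  intro Q hQ
  rw [hχI, Ideal.map_le_iff_le_comap, hχT Q hQ, Ideal.mem_comap]

end Radical

/-! ## §3 The frame at a point presented by a leaf chart -/

section Frame

variable (n : ℕ) (k : Type) [Field k]

/-- **`dim 𝒪_{F,x} = n`** when `𝒪_{F,x}` is the localisation of `k[t₁, …, tₙ]` at a rational point. [cite: Matsumura1987, §5 Example 5.1] -/
theorem ringKrullDim_stalk_eq_of_leafChart {F : Scheme.{0}} (x : F) (b : Fin n → k)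
    (χ : MvPolynomial (Fin n) k →+* F.presheaf.stalk x)
    (hχ : letI := χ.toAlgebra; IsLocalization.AtPrime (F.presheaf.stalk x) (MvPolynomial.vanishingIdeal k {b})) :
    ringKrullDim (F.presheaf.stalk x) = (n : WithBot ℕ∞) := by
  letI := χ.toAlgebra
  haveI := hχ
  haveI : (MvPolynomial.vanishingIdeal k ({b} : Set (Fin n → k))).IsMaximal := inferInstance
  rw [IsLocalization.AtPrime.ringKrullDim_eq_height (MvPolynomial.vanishingIdeal k ({b} : Set (Fin n → k))) (F.presheaf.stalk x),
    Literature.AlgebraicGeometry.Resolution.MvPolynomial.height_eq_of_isMaximal k n (MvPolynomial.vanishingIdeal k ({b} : Set (Fin n → k)))]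
  rfl

/-- **THE FRAME from a leaf chart.**  `F` locally Noetherian, `x ∈ F`, `χ : k[t] → 𝒪_{F,x}` a localisation at the rational point `b` with
`χ ∘ C = ND.baseToStalk n k ρ x`, `θ` an origin-fixing `k`-automorphism of `k[t]`.  Then there are ideal sheaves `W₁, …, Wₙ` on `F` with germs
`w_j = χ((θ⁻¹ t_j)(t − b))` at `x`, `(w₁, …, wₙ) = 𝔪_x`, `dim 𝒪_{F,x} = n`, and `(θ (f(t + b)))(w) = χ f` for every `f ∈ k[t]` (coefficients through
`ND.baseToStalk`).  (027 g20's `exists_frame` for `ℙⁿ_k`, p645036, verbatim with `F` for `ℙⁿ_k`; the `W_j` by `exists_idealSheafData_stalkIdeal_eq`.)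
[cite: Matsumura1987, §5 Example 5.1] -/
theorem exists_frame_of_leafChart {F : Scheme.{0}} [IsLocallyNoetherian F] (ρ : F ⟶ (projectiveSpace n k).left) (x : F) (b : Fin n → k)
    (χ : MvPolynomial (Fin n) k →+* F.presheaf.stalk x)
    (hχ : letI := χ.toAlgebra; IsLocalization.AtPrime (F.presheaf.stalk x) (MvPolynomial.vanishingIdeal k {b}))
    (hC : χ.comp MvPolynomial.C = baseToStalk n k ρ x)
    (θ : MvPolynomial (Fin n) k ≃ₐ[k] MvPolynomial (Fin n) k) (hθ : FixesOrigin θ) :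
    ∃ (W : Fin n → F.IdealSheafData) (w : Fin n → F.presheaf.stalk x),
      (∀ j, w j = χ (translate (-b) (θ.symm (X j)))) ∧
      (∀ j, stalkIdeal (W j) x = Ideal.span {w j}) ∧
      Ideal.span (Set.range w) = maximalIdeal (F.presheaf.stalk x) ∧
      ringKrullDim (F.presheaf.stalk x) = (n : WithBot ℕ∞) ∧
      ∀ f : MvPolynomial (Fin n) k, MvPolynomial.eval₂ (baseToStalk n k ρ x) w (θ (translate b f)) = χ f := by
  classical
  letI := χ.toAlgebra
  haveI := hχ
  choose W hW using fun j => exists_idealSheafData_stalkIdeal_eq F x (Ideal.span {χ (translate (-b) (θ.symm (X j)))})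
  refine ⟨W, fun j => χ (translate (-b) (θ.symm (X j))), fun j => rfl, hW, ?_, ringKrullDim_stalk_eq_of_leafChart n k x b χ hχ, fun f => ?_⟩
  · -- `(w) = 𝔪_x`
    have h1 : Ideal.span (Set.range fun j => χ (translate (-b) (θ.symm (X j)))) =
        (Ideal.span (Set.range fun j => translate (-b) (θ.symm (X j)))).map χ := by
      rw [Ideal.map_span, ← Set.range_comp]
      rfl
    rw [h1, span_range_recentre_eq_vanishingIdeal θ hθ b]
    exact IsLocalization.AtPrime.map_eq_maximalIdeal (MvPolynomial.vanishingIdeal k ({b} : Set (Fin n → k))) (F.presheaf.stalk x)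
  · -- `g(w) = χ f`
    have h1 : MvPolynomial.eval₂ (baseToStalk n k ρ x) (fun j => χ (translate (-b) (θ.symm (X j)))) (θ (translate b f)) =
        χ (MvPolynomial.eval₂ MvPolynomial.C (fun j => translate (-b) (θ.symm (X j))) (θ (translate b f))) := by
      rw [← hC]
      exact (MvPolynomial.eval₂_comp_left χ MvPolynomial.C _ _).symm
    rw [h1, ← MvPolynomial.algebraMap_eq, ← MvPolynomial.aeval_def, aeval_recentre_localCoords θ b f]

end Frame

/-! ## §4 (K6-L1) The supplier proper -/

section Supplier

variable (n : ℕ) (k : Type) [Field k]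

/-- **`(𝓘_{T̂})_x = (χ f)` at a leaf.**  `F` regular, leaf chart `χ` at the rational point `b`, `f ∈ k[t]` cutting out the reduced closure `T̂` of `T`
near `x` AT THE LEVEL OF POINTS (`∀ Q prime, (𝓘_{T̂})_x ≤ Q ↔ χ f ∈ Q`), and `LocalND (θ (f(t + b)))` for an origin-fixing `θ`, `2 ≤ n`.  Then the
stalk IDEAL is generated by `χ f`: by (γ5) `sq_dvd_false_of_localND` no `P` with `P(b) = 0` has `P² ∣ f`, so `χ f` is squarefree in the factorial
`𝒪_{F,x}` (`squarefree_algebraMap_of_forall_not_sq_dvd`), `(χ f)` is radical, and §2 applies. [OURS · K6 (K6-L1) · ideal equality] -/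
theorem stalkIdeal_eq_span_of_leafChart [IsAlgClosed k] (hn : 2 ≤ n) {F : Scheme.{0}} (T : Set F) (hF : Scheme.IsRegular F)
    [IsLocallyNoetherian F] (x : F) (b : Fin n → k) (χ : MvPolynomial (Fin n) k →+* F.presheaf.stalk x)
    (hχ : letI := χ.toAlgebra; IsLocalization.AtPrime (F.presheaf.stalk x) (MvPolynomial.vanishingIdeal k {b}))
    (f : MvPolynomial (Fin n) k)
    (hT : ∀ Q : Ideal (F.presheaf.stalk x), Q.IsPrime →
      (stalkIdeal (vanishingIdeal (⟨closure T, isClosed_closure⟩ : Closeds F)) x ≤ Q ↔ χ f ∈ Q))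
    (θ : MvPolynomial (Fin n) k ≃ₐ[k] MvPolynomial (Fin n) k) (hθ : FixesOrigin θ) (hg : LocalND (θ (translate b f))) :
    stalkIdeal (vanishingIdeal (⟨closure T, isClosed_closure⟩ : Closeds F)) x = Ideal.span {χ f} := by
  classical
  letI := χ.toAlgebra
  haveI := hχ
  haveI : UniqueFactorizationMonoid (F.presheaf.stalk x) := hF.uniqueFactorizationMonoid_stalk x
  have hf0 : f ≠ 0 := by
    intro h
    apply ne_zero_of_isLocallyND hg.2
    rw [h, show translate b (0 : MvPolynomial (Fin n) k) = 0 from map_zero _, map_zero]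
  have hQ : ∀ p, p ∈ MvPolynomial.vanishingIdeal k ({b} : Set (Fin n → k)) ↔ MvPolynomial.eval b p = 0 := by
    intro p
    rw [MvPolynomial.mem_vanishingIdeal_singleton_iff]
    exact Iff.rfl
  have hsq : Squarefree (χ f) :=
    squarefree_algebraMap_of_forall_not_sq_dvd (MvPolynomial.vanishingIdeal k ({b} : Set (Fin n → k))) b hQ hf0 fun P hP hdvd =>
      sq_dvd_false_of_localND hn hg
        (show constantCoeff (θ (translate b P)) = 0 by
          rw [constantCoeff_apply_of_fixesOrigin θ hθ, constantCoeff_translate]; exact hP)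
        (by
          have h1 : translate b P * translate b P ∣ translate b f := by
            unfold translate; rw [← map_mul]; exact map_dvd _ hdvd
          rw [pow_two, ← map_mul]; exact map_dvd θ h1)
  have hrad : (Ideal.span {χ f}).IsRadical := isRadical_iff_span_singleton.mp hsq.isRadical
  exact stalkIdeal_vanishingIdeal_eq_span_of_forall_isPrime _ x (χ f) hT hrad

/-- **(K6-L1) ★ `isNDFrameAt_of_leafChart` — THE LEAF-INIT SUPPLIER PROPER** (the stage-generic replacement of `ND.ndInv_init`'s chart step).
DATA at a point `x` of a k-side stage `(F, ρ, T)` with `F` regular and locally Noetherian, `k` algebraically closed, `2 ≤ n`: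
* a LEAF CHART `χ : k[t₁, …, tₙ] →+* 𝒪_{F,x}`, a localisation at the rational point `b` (`IsLocalization.AtPrime` at `𝔪_b`), `k`-linear
  (`χ ∘ C = ND.baseToStalk n k ρ x`) — supplied by `ℙⁿ_k` (`ND.exists_chartRingHom`) and by toric stages ((TS1) charts `𝔸ⁿ_k ⟶ F`);
* a polynomial `f` cutting out the reduced closure `T̂` of `T` near `x` AT THE LEVEL OF POINTS: `∀ Q prime, (𝓘_{T̂})_x ≤ Q ↔ χ f ∈ Q`
  (from chart clauses by `primes_iff_of_chart`);
* the ND datum in the recentred frame: `LocalNDWon (θ (f(t + b)))` for an origin-fixing `θ`.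
CONCLUSION: local ND frame data `ND.IsNDFrameAt n k ρ T W x` (p639684) for some frame `W` — with germs `w_j = χ((θ⁻¹ t_j)(t − b))`, `g = θ (f(t + b))`,
and the IDEAL equality `(𝓘_{T̂})_x = (g(w)) = (χ f)` of `stalkIdeal_eq_span_of_leafChart`. [OURS · K6 (K6-L1)] -/
theorem isNDFrameAt_of_leafChart [IsAlgClosed k] (hn : 2 ≤ n) {F : Scheme.{0}} (ρ : F ⟶ (projectiveSpace n k).left) (T : Set F)
    (hF : Scheme.IsRegular F) [IsLocallyNoetherian F] (x : F) (b : Fin n → k) (χ : MvPolynomial (Fin n) k →+* F.presheaf.stalk x)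
    (hχ : letI := χ.toAlgebra; IsLocalization.AtPrime (F.presheaf.stalk x) (MvPolynomial.vanishingIdeal k {b}))
    (hC : χ.comp MvPolynomial.C = baseToStalk n k ρ x) (f : MvPolynomial (Fin n) k)
    (hT : ∀ Q : Ideal (F.presheaf.stalk x), Q.IsPrime →
      (stalkIdeal (vanishingIdeal (⟨closure T, isClosed_closure⟩ : Closeds F)) x ≤ Q ↔ χ f ∈ Q))
    (θ : MvPolynomial (Fin n) k ≃ₐ[k] MvPolynomial (Fin n) k) (hθ : FixesOrigin θ) (hg : LocalNDWon (θ (translate b f))) :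
    ∃ W : Fin n → F.IdealSheafData, IsNDFrameAt n k ρ T W x := by
  obtain ⟨W, w, -, h2, h3, h4, h5⟩ := exists_frame_of_leafChart n k ρ x b χ hχ hC θ hθ
  refine ⟨W, w, θ (translate b f), h2, h3, h4, hg, ?_⟩
  rw [h5 f]
  exact stalkIdeal_eq_span_of_leafChart n k hn T hF x b χ hχ f hT θ hθ hg.1

end Supplier

/-! ## §5 Prescribed frame members (optional adaptedness, crit-2 S-C2-40a) -/

section Prescribed

variable (n : ℕ) (k : Type) [Field k]

/-- Replacing frame members by PRESCRIBED ideal sheaves with the same stalk at `x` keeps `ND.IsNDFrameAt` (the predicate reads the `W_j` only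
through `stalkIdeal (W j) x`). [OURS · K6 · bookkeeping] -/
theorem isNDFrameAt_congr_stalk {F : Scheme.{0}} (ρ : F ⟶ (projectiveSpace n k).left) (T : Set F) {W W' : Fin n → F.IdealSheafData} (x : F)
    (hWW' : ∀ j, stalkIdeal (W' j) x = stalkIdeal (W j) x) (h : IsNDFrameAt n k ρ T W x) : IsNDFrameAt n k ρ T W' x := by
  obtain ⟨w, g, h1, h2, h3, h4, h5⟩ := h
  exact ⟨w, g, fun j => (hWW' j).trans (h1 j), h2, h3, h4, h5⟩

/-- **(K6-L1′) `isNDFrameAt_of_leafChart_prescribed`** — as `isNDFrameAt_of_leafChart`, with `r ≤ n` PRESCRIBED ideal sheaves `D₁, …, D_r` whose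
stalks at `x` are the first `r` frame coordinates `(χ((θ⁻¹ t_j)(t − b)))` (e.g. the boundary members through `x`): the frame can be chosen with
`W (castLE j) = D j`, so every prescribed member IS a frame member (adaptedness in crit-2's S-C2-40a wording follows by `rfl`). [OURS · K6 (K6-L1′)] -/
theorem isNDFrameAt_of_leafChart_prescribed [IsAlgClosed k] (hn : 2 ≤ n) {F : Scheme.{0}} (ρ : F ⟶ (projectiveSpace n k).left)
    (T : Set F) (hF : Scheme.IsRegular F) [IsLocallyNoetherian F] (x : F) (b : Fin n → k)
    (χ : MvPolynomial (Fin n) k →+* F.presheaf.stalk x)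
    (hχ : letI := χ.toAlgebra; IsLocalization.AtPrime (F.presheaf.stalk x) (MvPolynomial.vanishingIdeal k {b}))
    (hC : χ.comp MvPolynomial.C = baseToStalk n k ρ x) (f : MvPolynomial (Fin n) k)
    (hT : ∀ Q : Ideal (F.presheaf.stalk x), Q.IsPrime →
      (stalkIdeal (vanishingIdeal (⟨closure T, isClosed_closure⟩ : Closeds F)) x ≤ Q ↔ χ f ∈ Q))
    (θ : MvPolynomial (Fin n) k ≃ₐ[k] MvPolynomial (Fin n) k) (hθ : FixesOrigin θ) (hg : LocalNDWon (θ (translate b f)))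
    {r : ℕ} (hr : r ≤ n) (D : Fin r → F.IdealSheafData)
    (hD : ∀ j : Fin r, stalkIdeal (D j) x = Ideal.span {χ (translate (-b) (θ.symm (X (Fin.castLE hr j))))}) :
    ∃ W : Fin n → F.IdealSheafData, (∀ j : Fin r, W (Fin.castLE hr j) = D j) ∧ IsNDFrameAt n k ρ T W x := by
  classical
  obtain ⟨W, w, h1, h2, h3, h4, h5⟩ := exists_frame_of_leafChart n k ρ x b χ hχ hC θ hθ
  have hW : IsNDFrameAt n k ρ T W x := by
    refine ⟨w, θ (translate b f), h2, h3, h4, hg, ?_⟩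
    rw [h5 f]
    exact stalkIdeal_eq_span_of_leafChart n k hn T hF x b χ hχ f hT θ hθ hg.1
  -- overwrite the members at the prescribed indices
  let W' : Fin n → F.IdealSheafData := fun j =>
    if h : ∃ j' : Fin r, Fin.castLE hr j' = j then D h.choose else W j
  have hinj : Function.Injective (Fin.castLE hr : Fin r → Fin n) := Fin.castLE_injective hr
  refine ⟨W', fun j => ?_, isNDFrameAt_congr_stalk n k ρ T x (fun j => ?_) hW⟩
  · have h : ∃ j' : Fin r, Fin.castLE hr j' = Fin.castLE hr j := ⟨j, rfl⟩
    simp only [W', dif_pos h]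
    rw [hinj h.choose_spec]
  · by_cases h : ∃ j' : Fin r, Fin.castLE hr j' = j
    · simp only [W', dif_pos h]
      rw [hD, h2 j, h1 j, h.choose_spec]
    · simp only [W', dif_neg h]

end Prescribed

end Summit.ResolutionOfSingularities.ResolutionOfSingularities.Cruxes.EquisingularLiftNat.Sections.ND

end
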